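import Summits.ValiantsHypothesis.ValiantsHypothesis.Theorems.KPlusLogSqLawStaticTridiagonalLaw

/-!
# Route «KPlusLogSqLaw» — the static tridiagonal `O(m log m)` chain law for ARBITRARY supports (absent band entries allowed)

HONEST FRAMING.  Helper toward the crux `WeakLifting` (item `stmt-ValiantsHypothesis-19561`, route `KPlusLogSqLaw`, cell `pub-symmetroid`,
seat val-sym-lift-p3 g7, 2026-08-27) on the line of its witness-plan stub `stub_tridiagonalSectorB`: the TROPICAL side of the STATIC
tridiagonal sub-sector.  The unconditional law `StaticTridiagonal.chain_le` (this seat, `…StaticTridiagonalLaw`) is stated for FULL static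
tridiagonal designs — every entry `(i, j)` with `|i − j| ≤ 1` carries exactly its class `cls i j`.  Real tridiagonal supports have holes
(absent links split the matrix, absent diagonal entries force swaps), so here the law is extended to EVERY STATIC TRIDIAGONAL DESIGN: the
hypothesis is only `ε i j l ≠ 0 → (|i − j| ≤ 1 ∧ l = cls i j)` (each entry carries AT MOST one class, read off a class table, and nothing
outside the band).  PROOF (`StaticTridiagonal.isDominant_fill`): FILL the holes — make every absent band entry present (sign `1`) with a huge
valuation `M = 2·(Σ_k |θ_k|)·m·(Σ_l d_l) + 2·Σ |v| + 1`; every term of the filled design that uses a filled entry has tropical weight below every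
term of the original design at each slope `θ_k` of the chain, and terms avoiding the filled entries keep their weight, so each dominant term of the
original chain stays dominant in the filled (now FULL) design, to which `chain_le` applies.  RESULT (`StaticTridiagonal.chain_le_of_support`,
`chain_le_of_support_alternating`): **every chain of distinct consecutive `IsDominant` terms (in particular every alternating chain counted by
`TropRootLawAt`) of ANY static tridiagonal dominance design of size `m` has at most `66 · (m−1) · (⌊log₂ (m−1)⌋ + 2)` steps**, uniformly in `K`,
the exponents and the support.  Nothing here asserts anything about `WeakLifting`, `TropicalB`, `KPlusLogSqLaw`, the stub in its window (its REAL
side), `MatrixDescartes` (stmt-ValiantsHypothesis-18050) or `VP ≠ VNP`.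
[folklore] (big-M completion of a support; bookkeeping).
-/

set_option linter.dupNamespace false
set_option autoImplicit false

namespace Summit.ValiantsHypothesis.ValiantsHypothesis.Theorems.KPlusLogSqLaw

open Finset Classical
open Summit.ValiantsHypothesis.ValiantsHypothesis.Theorems.MatrixDescartes.Negative

namespace StaticTridiagonal

variable {m K : ℕ}

/-! ## 1. Bounds on slopes and valuations of a term -/

/-- the slope of a term is between `0` and `m · Σ_l d_l`. [folklore] -/
theorem slope_le (d : Fin K → ℕ) (p : Equiv.Perm (Fin m) × (Fin m → Fin K)) :
    0 ≤ ∑ i, (d (p.2 i) : ℤ) ∧ ∑ i, (d (p.2 i) : ℤ) ≤ (m : ℤ) * ∑ l, (d l : ℤ) := by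
  refine ⟨sum_nonneg fun i _ => by positivity, ?_⟩
  calc ∑ i, (d (p.2 i) : ℤ) ≤ ∑ _i : Fin m, ∑ l, (d l : ℤ) :=
        sum_le_sum fun i _ => single_le_sum (f := fun l => (d l : ℤ)) (fun l _ => by positivity) (mem_univ (p.2 i))
    _ = (m : ℤ) * ∑ l, (d l : ℤ) := by rw [sum_const, card_univ, Fintype.card_fin, nsmul_eq_mul]

/-- the valuations met by a term are bounded in absolute value by the total `Σ_{i,j,l} |v j i l|`. [folklore] -/
theorem sum_abs_val_le (v : Fin m → Fin m → Fin K → ℤ) (p : Equiv.Perm (Fin m) × (Fin m → Fin K)) :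
    ∑ i, |v (p.1 i) i (p.2 i)| ≤ ∑ i, ∑ j, ∑ l, |v j i l| := by
  refine sum_le_sum fun i _ => ?_
  calc |v (p.1 i) i (p.2 i)| ≤ ∑ l, |v (p.1 i) i l| :=
        single_le_sum (f := fun l => |v (p.1 i) i l|) (fun l _ => abs_nonneg _) (mem_univ (p.2 i))
    _ ≤ ∑ j, ∑ l, |v j i l| :=
        single_le_sum (f := fun j => ∑ l, |v j i l|) (fun j _ => sum_nonneg fun l _ => abs_nonneg _) (mem_univ (p.1 i))

/-- lower bound for the tropical weight of any term: `−|θ|·m·Σd − Σ|v|`. [folklore] -/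
theorem tropWeight_ge (d : Fin K → ℕ) (v : Fin m → Fin m → Fin K → ℤ) (θ : ℤ) (p : Equiv.Perm (Fin m) × (Fin m → Fin K)) :
    -(|θ| * ((m : ℤ) * ∑ l, (d l : ℤ))) - ∑ i, ∑ j, ∑ l, |v j i l| ≤ tropWeight d v θ p := by
  unfold tropWeight
  obtain ⟨h0, h1⟩ := slope_le d p
  have h2 := sum_abs_val_le v p
  have h3 : ∑ i, v (p.1 i) i (p.2 i) ≤ ∑ i, |v (p.1 i) i (p.2 i)| := sum_le_sum fun i _ => le_abs_self _
  have h4 : -(|θ| * ((m : ℤ) * ∑ l, (d l : ℤ))) ≤ θ * ∑ i, (d (p.2 i) : ℤ) := by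
    have h5 : -(|θ| * ∑ i, (d (p.2 i) : ℤ)) ≤ θ * ∑ i, (d (p.2 i) : ℤ) := by
      have := neg_abs_le θ
      nlinarith
    have h6 : |θ| * ∑ i, (d (p.2 i) : ℤ) ≤ |θ| * ((m : ℤ) * ∑ l, (d l : ℤ)) := mul_le_mul_of_nonneg_left h1 (abs_nonneg θ)
    linarith
  linarith

/-! ## 2. Filling the holes of a static tridiagonal support -/

/-- **filling preserves dominance.**  Let `ε` be static tridiagonal for the class table `cls` (`ε i j l ≠ 0 → |i−j| ≤ 1 ∧ l = cls i j`), let `ε'`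
be its FULL completion (absent band entries get sign `1`) and `v'` the valuation table that keeps `v` on present entries and puts `M` on absent ones,
with `M ≥ 2·|θ|·m·Σ_l d_l + 2·Σ|v| + 1`.  Then a term dominant for `(d, v, ε)` at `θ` is dominant for `(d, v', ε')` at `θ`. [folklore] -/
theorem isDominant_fill (d : Fin K → ℕ) (v ε : Fin m → Fin m → Fin K → ℤ) (cls : Fin m → Fin m → Fin K)
    (hε : ∀ i j l, ε i j l ≠ 0 → (((i : ℕ) ≤ j + 1 ∧ (j : ℕ) ≤ i + 1) ∧ l = cls i j))
    (M : ℤ) (ε' v' : Fin m → Fin m → Fin K → ℤ)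
    (hε' : ∀ i j l, ε' i j l = if (((i : ℕ) ≤ j + 1 ∧ (j : ℕ) ≤ i + 1) ∧ l = cls i j) then (if ε i j l = 0 then 1 else ε i j l) else 0)
    (hv' : ∀ i j l, v' i j l = if ε i j l = 0 then M else v i j l)
    (θ : ℤ) (hM : 2 * (|θ| * ((m : ℤ) * ∑ l, (d l : ℤ))) + 2 * ∑ i, ∑ j, ∑ l, |v j i l| + 1 ≤ M)
    {p : Equiv.Perm (Fin m) × (Fin m → Fin K)} (hp : IsDominant d v ε θ p) : IsDominant d v' ε' θ p := by
  -- present entries keep their sign and valuation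
  have hpres_eps : ∀ i j l, ε i j l ≠ 0 → ε' i j l = ε i j l := fun i j l h => by
    rw [hε', if_pos (hε i j l h), if_neg h]
  have hpres_v : ∀ i j l, ε i j l ≠ 0 → v' i j l = v i j l := fun i j l h => by rw [hv', if_neg h]
  -- a term present for `ε` is present for `ε'` with the same sign, and has the same weight under `v'`
  have hsign : ∀ q : Equiv.Perm (Fin m) × (Fin m → Fin K), termSign ε q ≠ 0 → termSign ε' q = termSign ε q := by
    intro q hq
    unfold termSign at hq ⊢
    have hprod : ∏ i, ε (q.1 i) i (q.2 i) ≠ 0 := fun h => hq (by rw [h, mul_zero])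
    rw [prod_ne_zero_iff] at hprod
    congr 1
    exact prod_congr rfl fun i _ => hpres_eps _ _ _ (hprod i (mem_univ i))
  have hweight : ∀ q : Equiv.Perm (Fin m) × (Fin m → Fin K), termSign ε q ≠ 0 → tropWeight d v' θ q = tropWeight d v θ q := by
    intro q hq
    unfold termSign at hq
    have hprod : ∏ i, ε (q.1 i) i (q.2 i) ≠ 0 := fun h => hq (by rw [h, mul_zero])
    rw [prod_ne_zero_iff] at hprod
    unfold tropWeight
    congr 1
    exact sum_congr rfl fun i _ => hpres_v _ _ _ (hprod i (mem_univ i))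
  refine ⟨by rw [hsign p hp.1]; exact hp.1, fun q hne hq' => ?_⟩
  by_cases hq : termSign ε q ≠ 0
  · -- an old term: original dominance
    rw [hweight q hq, hweight p hp.1]
    exact hp.2 q hne hq
  · -- a new term: it uses an absent entry, whose valuation `M` sinks it
    rw [not_ne_iff] at hq
    have hsignq : (Equiv.Perm.sign q.1 : ℤ) ≠ 0 := by exact_mod_cast (Equiv.Perm.sign q.1).ne_zero
    have hprod0 : ∏ i, ε (q.1 i) i (q.2 i) = 0 := by
      unfold termSign at hq
      rcases mul_eq_zero.mp hq with h | h
      · exact absurd h hsignq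
      · exact h
    obtain ⟨i₀, -, hi₀⟩ := prod_eq_zero_iff.mp hprod0
    -- valuations of `q` under `v'`: `M` at `i₀`, at least `−|v|` elsewhere
    have hvi : ∀ i, -|v (q.1 i) i (q.2 i)| ≤ v' (q.1 i) i (q.2 i) := by
      intro i
      rw [hv']
      split_ifs with h
      · have h1 : 0 ≤ |v (q.1 i) i (q.2 i)| := abs_nonneg _
        have h2 : (0 : ℤ) ≤ 2 * (|θ| * ((m : ℤ) * ∑ l, (d l : ℤ))) := by positivity
        have h3 : (0 : ℤ) ≤ ∑ i, ∑ j, ∑ l, |v j i l| := sum_nonneg fun _ _ => sum_nonneg fun _ _ => sum_nonneg fun _ _ => abs_nonneg _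
        linarith
      · exact neg_abs_le _
    have hvi₀ : v' (q.1 i₀) i₀ (q.2 i₀) = M := by rw [hv', if_pos hi₀]
    have hsumv : M - ∑ i, ∑ j, ∑ l, |v j i l| ≤ ∑ i, v' (q.1 i) i (q.2 i) := by
      have e1 : ∑ i, v' (q.1 i) i (q.2 i) = v' (q.1 i₀) i₀ (q.2 i₀) + ∑ i ∈ univ.erase i₀, v' (q.1 i) i (q.2 i) :=
        (add_sum_erase _ _ (mem_univ i₀)).symm
      have e2 : ∑ i ∈ univ.erase i₀, -|v (q.1 i) i (q.2 i)| ≤ ∑ i ∈ univ.erase i₀, v' (q.1 i) i (q.2 i) :=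
        sum_le_sum fun i _ => hvi i
      have e3 : -∑ i, |v (q.1 i) i (q.2 i)| ≤ ∑ i ∈ univ.erase i₀, -|v (q.1 i) i (q.2 i)| := by
        rw [sum_neg_distrib, neg_le_neg_iff]
        exact sum_le_sum_of_subset_of_nonneg (erase_subset _ _) fun i _ _ => abs_nonneg _
      have e4 := sum_abs_val_le v q
      linarith
    obtain ⟨_, hslope⟩ := slope_le d q
    have hwq : tropWeight d v' θ q ≤ |θ| * ((m : ℤ) * ∑ l, (d l : ℤ)) - (M - ∑ i, ∑ j, ∑ l, |v j i l|) := by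
      unfold tropWeight
      have h5 : θ * ∑ i, (d (q.2 i) : ℤ) ≤ |θ| * ((m : ℤ) * ∑ l, (d l : ℤ)) := by
        have h6 : θ * ∑ i, (d (q.2 i) : ℤ) ≤ |θ| * ∑ i, (d (q.2 i) : ℤ) := by
          have := le_abs_self θ
          have h0 : (0:ℤ) ≤ ∑ i, (d (q.2 i) : ℤ) := sum_nonneg fun i _ => by positivity
          nlinarith
        have h7 : |θ| * ∑ i, (d (q.2 i) : ℤ) ≤ |θ| * ((m : ℤ) * ∑ l, (d l : ℤ)) := mul_le_mul_of_nonneg_left hslope (abs_nonneg θ)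
        linarith
      linarith
    have hwp := tropWeight_ge d v θ p
    rw [hweight p hp.1]
    linarith

/-- the completed sign table is FULL static tridiagonal. [folklore] -/
theorem fill_full (ε : Fin m → Fin m → Fin K → ℤ) (cls : Fin m → Fin m → Fin K) (ε' : Fin m → Fin m → Fin K → ℤ)
    (hε' : ∀ i j l, ε' i j l = if (((i : ℕ) ≤ j + 1 ∧ (j : ℕ) ≤ i + 1) ∧ l = cls i j) then (if ε i j l = 0 then 1 else ε i j l) else 0)
    (i j : Fin m) (l : Fin K) : ε' i j l ≠ 0 ↔ (((i : ℕ) ≤ j + 1 ∧ (j : ℕ) ≤ i + 1) ∧ l = cls i j) := by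
  rw [hε']
  by_cases h : ((i : ℕ) ≤ j + 1 ∧ (j : ℕ) ≤ i + 1) ∧ l = cls i j
  · rw [if_pos h]
    refine ⟨fun _ => h, fun _ => ?_⟩
    split_ifs with h0
    · exact one_ne_zero
    · exact h0
  · rw [if_neg h]
    exact ⟨fun h0 => absurd rfl h0, fun h0 => absurd h0 h⟩

/-! ## 3. The law for arbitrary static tridiagonal supports -/

/-- **DOMINANT CHAINS OF ANY STATIC TRIDIAGONAL DESIGN HAVE `O(m log m)` TERMS**: if every present entry of the dominance design `(d, v, ε)` of
format `(m, K)` lies in the band `|i − j| ≤ 1` and carries the class `cls i j` (absent entries allowed anywhere), then every chain of distinct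
consecutive `IsDominant` terms at strictly increasing integer slopes has at most `66 · (m−1) · (⌊log₂ (m−1)⌋ + 2)` steps. [folklore] -/
theorem chain_le_of_support (d : Fin K → ℕ) (v ε : Fin m → Fin m → Fin K → ℤ) (cls : Fin m → Fin m → Fin K)
    (hε : ∀ i j l, ε i j l ≠ 0 → (((i : ℕ) ≤ j + 1 ∧ (j : ℕ) ≤ i + 1) ∧ l = cls i j))
    (n : ℕ) (θ : Fin (n + 1) → ℤ) (p : Fin (n + 1) → Equiv.Perm (Fin m) × (Fin m → Fin K)) (hθ : StrictMono θ)
    (hdom : ∀ k, IsDominant d v ε (θ k) (p k)) (hne : ∀ k : Fin n, p k.castSucc ≠ p k.succ) :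
    n ≤ 66 * (m - 1) * (Nat.log 2 (m - 1) + 2) := by
  -- the big constant and the completed tables (local functions; defining equations are `rfl`)
  set M : ℤ := 2 * ((∑ k, |θ k|) * ((m : ℤ) * ∑ l, (d l : ℤ))) + 2 * ∑ i, ∑ j, ∑ l, |v j i l| + 1 with hM
  set ε' : Fin m → Fin m → Fin K → ℤ := fun i j l =>
    if (((i : ℕ) ≤ j + 1 ∧ (j : ℕ) ≤ i + 1) ∧ l = cls i j) then (if ε i j l = 0 then 1 else ε i j l) else 0 with hε'def
  set v' : Fin m → Fin m → Fin K → ℤ := fun i j l => if ε i j l = 0 then M else v i j l with hv'def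
  have hε' : ∀ i j l, ε' i j l ≠ 0 ↔ (((i : ℕ) ≤ j + 1 ∧ (j : ℕ) ≤ i + 1) ∧ l = cls i j) :=
    fill_full ε cls ε' (fun i j l => rfl)
  refine chain_le d v' ε' cls hε' n θ p hθ (fun k => ?_) hne
  refine isDominant_fill d v ε cls hε M ε' v' (fun i j l => rfl) (fun i j l => rfl) (θ k) ?_ (hdom k)
  -- `|θ k| ≤ Σ_k |θ k|`
  have h1 : |θ k| ≤ ∑ k, |θ k| := single_le_sum (f := fun k => |θ k|) (fun k _ => abs_nonneg _) (mem_univ k)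
  have h2 : (0 : ℤ) ≤ (m : ℤ) * ∑ l, (d l : ℤ) := by positivity
  have h3 : |θ k| * ((m : ℤ) * ∑ l, (d l : ℤ)) ≤ (∑ k, |θ k|) * ((m : ℤ) * ∑ l, (d l : ℤ)) := mul_le_mul_of_nonneg_right h1 h2
  rw [hM]
  linarith

/-- **corollary in `TropRootLawAt` currency**: an ALTERNATING chain of dominant terms of any static tridiagonal design has at most
`66 · (m−1) · (⌊log₂ (m−1)⌋ + 2)` alternations. [folklore] -/
theorem chain_le_of_support_alternating (d : Fin K → ℕ) (v ε : Fin m → Fin m → Fin K → ℤ) (cls : Fin m → Fin m → Fin K)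
    (hε : ∀ i j l, ε i j l ≠ 0 → (((i : ℕ) ≤ j + 1 ∧ (j : ℕ) ≤ i + 1) ∧ l = cls i j))
    (n : ℕ) (θ : Fin (n + 1) → ℤ) (p : Fin (n + 1) → Equiv.Perm (Fin m) × (Fin m → Fin K)) (hθ : StrictMono θ)
    (hdom : ∀ k, IsDominant d v ε (θ k) (p k))
    (halt : ∀ k : Fin n, termSign ε (p k.castSucc) * termSign ε (p k.succ) < 0) :
    n ≤ 66 * (m - 1) * (Nat.log 2 (m - 1) + 2) := by
  refine chain_le_of_support d v ε cls hε n θ p hθ hdom fun k heq => ?_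
  have h := halt k
  rw [heq] at h
  exact absurd h (not_lt.mpr (mul_self_nonneg _))

end StaticTridiagonal

end Summit.ValiantsHypothesis.ValiantsHypothesis.Theorems.KPlusLogSqLaw
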